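/-
Copyright (c) 2026. All rights reserved.
Released under Apache 2.0 license as described in the file LICENSE.
Authors: HodgeCM publication cell (pub-hodgecm), model-construction sub-cell, construction prover `mc-weil-1`.
-/
import Literature.RepresentationTheory.HeisenbergGroup.RankOneGeneration
import Literature.NumberTheory.Automorphic.TateSelfDualHaar

/-!
# Rank one: the commutant of the smooth Schrödinger model is `ℂ`, and implementers are unique up to a scalar

Topic `RepresentationTheory/HeisenbergGroup`; namespace `Literature.RepresentationTheory.HeisenbergGroup`.

KERNEL throughout; no records. `F` a non-archimedean local field, `ψ` continuous non-trivial (conductor `𝔭^m`),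
`ρ = schrodingerSB (mul F F) ψ` the smooth Schrödinger model on `𝒮(F)`: `(ρ((x,y),t) f)(u) = ψ(t + u y) f(u + x)`.
* §1 (= `NumberTheory/Automorphic/TateSelfDualHaar` §1, imported) step functions: cosets `a + 𝔭^N` are equal or
  disjoint, and a Schwartz–Bruhat function is a FINITE sum `f = Σ_B 1_B f` over cosets of `𝔭^N`
  (`exists_finset_eq_sum_indicator`);
* §2 **the commutant** (`commutant_schrodingerSB_rankOne`): a `ℂ`-linear `T : 𝒮(F) → 𝒮(F)` commuting with every
  `ρ(h)` is a scalar. Proof (MVW Chap. 2 I.3's argument, made finite): `g = T 1_{𝔭^N}` is fixed by the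
  modulations `ψ(u y)`, `y ∈ 𝔭^{m-N}`, hence vanishes off `𝔭^N` (conductor: some such `y` has `ψ(uy) ≠ 1`,
  the tree's `exists_mem_primePowBall_addChar_mul_ne_one`), and by the translations `x ∈ 𝔭^N`, hence is constant
  on `𝔭^N`: `T 1_{𝔭^N} = c_N 1_{𝔭^N}` (`commutant_ballSB`); by §1 and translation `T f = c_N f` for every
  `𝔭^N`-invariant `f` (`commutant_eq_smul_of_forall_add_eq`), and `c_N = c_0` by applying this to `1_𝒪`;
* §3 **uniqueness of implementers up to a scalar** (`implementerUniqueUpToScalar_schrodingerSB_rankOne`): two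
  implementers `M, M'` of the same `g` give `M⁻¹M'` in the commutant — this DISCHARGES, in rank one, the predicate
  `ImplementerUniqueUpToScalar` of `LocalWeilProjective.lean` (MVW II.1 "`M` est unique à un scalaire près");
* §4 with `RankOneGeneration.lean` (existence) and `TateSelfDualHaar.lean` (a self-dual Haar measure EXISTS,
  kernel): **for every continuous non-trivial `ψ` (and `2 ≠ 0`), the rank-one local metaplectic-type extension
  `1 → ℂˣ → S̃p_ψ(W) → SL₂(F) → 1` is a central extension with `ker p = im i`, KERNEL, NO further hypothesis**
  (`isCentralExt_schrodingerSB_rankOne'`; the `μ`-explicit form is `isCentralExt_schrodingerSB_rankOne`).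
-/

set_option autoImplicit false

noncomputable section

namespace Literature.RepresentationTheory.HeisenbergGroup

open _root_.MeasureTheory
open Literature.NumberTheory.Automorphic
open Literature.NumberTheory.GaloisRepresentations.IsNonarchimedeanLocalField
open Literature.RepresentationTheory.MoeglinVignerasWaldspurger1987 (IsCentralExt)
open scoped Pointwise

/-! ## §1 Cosets of balls; step functions: see `Literature/NumberTheory/Automorphic/TateSelfDualHaar.lean` §1
(`mem_vadd_primePowBall_iff`, `vadd_primePowBall_eq_of_mem`, `indicator_vadd_primePowBall_eq`,
`exists_finset_eq_sum_indicator`, …), imported. -/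

/-! ## §2 The commutant of the smooth Schrödinger model -/

section Commutant

variable {F : Type*} [Field F] [ValuativeRel F] [TopologicalSpace F] [IsNonarchimedeanLocalField F]
  (ψ : AddChar F Circle) (hl : IsLocallyConstant (⇑ψ : F → Circle))
  (hb : ∀ y : F, Continuous fun u : F => LinearMap.mul F F u y)

/-- the translation `((x, 0), 0)` of the rank-one Heisenberg group. [cite: MoeglinVignerasWaldspurger1987, Chap. 2 I.3] -/
def transl (x : F) : Heisenberg (polar (LinearMap.mul F F)) := ⟨(x, 0), 0⟩

/-- the modulation `((0, y), 0)` of the rank-one Heisenberg group. [cite: MoeglinVignerasWaldspurger1987, Chap. 2 I.3] -/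
def modul (y : F) : Heisenberg (polar (LinearMap.mul F F)) := ⟨(0, y), 0⟩

/-- translations act by `(ρ(x,0,0) f)(u) = f(u + x)`. [cite: MoeglinVignerasWaldspurger1987, Chap. 2 I.4 Exemple (1)] -/
theorem schrodingerSB_transl_apply (x : F) (f : SchwartzBruhat F) (u : F) :
    ((schrodingerSB (LinearMap.mul F F) ψ hl hb (transl x) f : SchwartzBruhat F) : F → ℂ) u = (f : F → ℂ) (u + x) := by
  rw [schrodingerSB_apply]
  simp only [transl, LinearMap.mul_apply', mul_zero, add_zero, AddChar.map_zero_eq_one, Circle.coe_one, one_mul]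

/-- modulations act by `(ρ(0,y,0) f)(u) = ψ(u y) f(u)`. [cite: MoeglinVignerasWaldspurger1987, Chap. 2 I.4 Exemple (1)] -/
theorem schrodingerSB_modul_apply (y : F) (f : SchwartzBruhat F) (u : F) :
    ((schrodingerSB (LinearMap.mul F F) ψ hl hb (modul y) f : SchwartzBruhat F) : F → ℂ) u
      = (ψ (u * y) : ℂ) * (f : F → ℂ) u := by
  rw [schrodingerSB_apply]
  simp only [modul, LinearMap.mul_apply', zero_add, add_zero]

variable (F) in
/-- the vector `1_{𝔭^N} ∈ 𝒮(F)`. [folklore] -/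
def ballSB (N : ℤ) : SchwartzBruhat F :=
  ⟨(primePowBall F N).indicator fun _ => (1 : ℂ), indicator_primePowBall_mem_schwartzBruhat N 1⟩

/-- its underlying function. [folklore] -/
@[simp] theorem coe_ballSB (N : ℤ) :
    ((ballSB F N : SchwartzBruhat F) : F → ℂ) = (primePowBall F N).indicator fun _ => (1 : ℂ) := rfl

variable {ψ}

/-- **`T 1_{𝔭^N} = c_N 1_{𝔭^N}`** for `T` in the commutant, `c_N = (T 1_{𝔭^N})(0)`: the image is fixed by the
modulations `y ∈ 𝔭^{m-N}` (so vanishes off `𝔭^N`, by the conductor) and by the translations `x ∈ 𝔭^N` (so is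
constant on `𝔭^N`). [cite: MoeglinVignerasWaldspurger1987, Chap. 2 I.3] -/
theorem commutant_ballSB {m : ℤ} (hm : ψ.HasConductorExp m) (T : SchwartzBruhat F →ₗ[ℂ] SchwartzBruhat F)
    (hT : ∀ (h : Heisenberg (polar (LinearMap.mul F F))) (f : SchwartzBruhat F),
      T (schrodingerSB (LinearMap.mul F F) ψ hl hb h f) = schrodingerSB (LinearMap.mul F F) ψ hl hb h (T f))
    (N : ℤ) : T (ballSB F N) = ((T (ballSB F N) : SchwartzBruhat F) : F → ℂ) 0 • ballSB F N := by
  -- (1) invariance under the modulations `y ∈ 𝔭^{m-N}`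
  have h1 : ∀ y ∈ primePowBall F (m - N), ∀ u,
      (ψ (u * y) : ℂ) * ((T (ballSB F N) : SchwartzBruhat F) : F → ℂ) u
        = ((T (ballSB F N) : SchwartzBruhat F) : F → ℂ) u := by
    intro y hy u
    have e : schrodingerSB (LinearMap.mul F F) ψ hl hb (modul y) (ballSB F N) = ballSB F N := by
      apply Subtype.ext
      funext v
      rw [schrodingerSB_modul_apply, coe_ballSB]
      by_cases hv : v ∈ primePowBall F N
      · have hvy : v * y ∈ primePowBall F m := by
          have := mul_mem_primePowBall hv hy; rwa [add_sub_cancel] at this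
        rw [hm.1 _ hvy, Circle.coe_one, one_mul]
      · rw [Set.indicator_of_notMem hv, mul_zero]
    have h := hT (modul y) (ballSB F N)
    rw [e] at h
    have h' := congr_arg (fun w : SchwartzBruhat F => (w : F → ℂ) u) h
    rw [schrodingerSB_modul_apply] at h'
    exact h'.symm
  -- (2) support in `𝔭^N`
  have h2 : ∀ u ∉ primePowBall F N, ((T (ballSB F N) : SchwartzBruhat F) : F → ℂ) u = 0 := by
    intro u hu
    have hu' : u ∉ primePowBall F (m - (m - N)) := by rwa [sub_sub_cancel]
    obtain ⟨y, hy, hne⟩ := exists_mem_primePowBall_addChar_mul_ne_one hm hu'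
    have h := h1 y hy u
    rw [mul_comm u y] at h
    have h3 : ((ψ (y * u) : ℂ) - 1) * ((T (ballSB F N) : SchwartzBruhat F) : F → ℂ) u = 0 := by
      rw [sub_mul, one_mul, h, sub_self]
    rcases mul_eq_zero.1 h3 with h4 | h4
    · exact absurd (Circle.coe_inj.1 (by rw [Circle.coe_one]; exact sub_eq_zero.1 h4)) hne
    · exact h4
  -- (3) invariance under the translations `x ∈ 𝔭^N`
  have h3 : ∀ x ∈ primePowBall F N, ∀ u, ((T (ballSB F N) : SchwartzBruhat F) : F → ℂ) (u + x)
      = ((T (ballSB F N) : SchwartzBruhat F) : F → ℂ) u := by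
    intro x hx u
    have e : schrodingerSB (LinearMap.mul F F) ψ hl hb (transl x) (ballSB F N) = ballSB F N := by
      apply Subtype.ext
      funext v
      rw [schrodingerSB_transl_apply, coe_ballSB, indicator_primePowBall_add_eq le_rfl v hx]
    have h := hT (transl x) (ballSB F N)
    rw [e] at h
    have h' := congr_arg (fun w : SchwartzBruhat F => (w : F → ℂ) u) h
    rw [schrodingerSB_transl_apply] at h'
    exact h'.symm
  -- conclusion
  apply Subtype.ext
  funext u
  rw [Submodule.coe_smul, Pi.smul_apply, smul_eq_mul, coe_ballSB]
  by_cases hu : u ∈ primePowBall F N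
  · rw [Set.indicator_of_mem hu, mul_one]
    have := h3 u hu 0
    rwa [zero_add] at this
  · rw [Set.indicator_of_notMem hu, mul_zero]
    exact h2 u hu

/-- **`T f = c_N f` for every `𝔭^N`-invariant `f ∈ 𝒮(F)`**, by the step decomposition and translation.
[cite: MoeglinVignerasWaldspurger1987, Chap. 2 I.3] -/
theorem commutant_eq_smul_of_forall_add_eq {m : ℤ} (hm : ψ.HasConductorExp m)
    (T : SchwartzBruhat F →ₗ[ℂ] SchwartzBruhat F)
    (hT : ∀ (h : Heisenberg (polar (LinearMap.mul F F))) (f : SchwartzBruhat F),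
      T (schrodingerSB (LinearMap.mul F F) ψ hl hb h f) = schrodingerSB (LinearMap.mul F F) ψ hl hb h (T f))
    {N : ℤ} (f : SchwartzBruhat F) (hf : ∀ x, ∀ t ∈ primePowBall F N, (f : F → ℂ) (x + t) = (f : F → ℂ) x) :
    T f = ((T (ballSB F N) : SchwartzBruhat F) : F → ℂ) 0 • f := by
  classical
  set c : ℂ := ((T (ballSB F N) : SchwartzBruhat F) : F → ℂ) 0 with hc_def
  have hχ : T (ballSB F N) = c • ballSB F N := by rw [hc_def]; exact commutant_ballSB hl hb hm T hT N
  obtain ⟨C, hC, hsum⟩ := exists_finset_eq_sum_indicator f.2 N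
  choose rep hrep using hC
  -- the pieces `1_B f = f(a_B) • ρ(-a_B, 0, 0) 1_{𝔭^N}`
  have key : ∀ (B : Set F) (hB : B ∈ C) (u : F), B.indicator (f : F → ℂ) u
      = ((((f : F → ℂ) (rep B hB)) • schrodingerSB (LinearMap.mul F F) ψ hl hb (transl (-(rep B hB))) (ballSB F N)
          : SchwartzBruhat F) : F → ℂ) u := by
    intro B hB u
    rw [indicator_vadd_primePowBall_eq hf (hrep B hB) u, Submodule.coe_smul, Pi.smul_apply, smul_eq_mul,
      schrodingerSB_transl_apply, coe_ballSB]
    congr 1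
    by_cases hu : u ∈ B
    · have hu' : u ∈ rep B hB +ᵥ primePowBall F N := by rw [← hrep B hB]; exact hu
      rw [mem_vadd_primePowBall_iff, sub_eq_add_neg] at hu'
      rw [Set.indicator_of_mem hu, Set.indicator_of_mem hu']
    · have hu' : u ∉ rep B hB +ᵥ primePowBall F N := by rw [← hrep B hB]; exact hu
      rw [mem_vadd_primePowBall_iff, sub_eq_add_neg] at hu'
      rw [Set.indicator_of_notMem hu, Set.indicator_of_notMem hu']
  have hf' : f = ∑ B ∈ C.attach, ((f : F → ℂ) (rep B.1 B.2)) •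
      schrodingerSB (LinearMap.mul F F) ψ hl hb (transl (-(rep B.1 B.2))) (ballSB F N) := by
    apply Subtype.ext
    rw [AddSubmonoidClass.coe_finsetSum]
    funext u
    rw [hsum u, Finset.sum_apply, ← Finset.sum_attach C (fun B => B.indicator (f : F → ℂ) u)]
    exact Finset.sum_congr rfl fun B _ => key B.1 B.2 u
  rw [hf', map_sum, Finset.smul_sum]
  refine Finset.sum_congr rfl fun B _ => ?_
  rw [map_smul, hT, hχ, map_smul, smul_comm]

/-- **the commutant of the smooth Schrödinger model of a non-archimedean local field is `ℂ`** (rank one): every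
`ℂ`-linear endomorphism of `𝒮(F)` commuting with all `ρ(h)` is a scalar. [cite: MoeglinVignerasWaldspurger1987, Chap. 2 I.3] -/
theorem commutant_schrodingerSB_rankOne (hψ : ψ.IsContinuousNontrivial)
    (T : SchwartzBruhat F →ₗ[ℂ] SchwartzBruhat F)
    (hT : ∀ (h : Heisenberg (polar (LinearMap.mul F F))) (f : SchwartzBruhat F),
      T (schrodingerSB (LinearMap.mul F F) ψ hl hb h f) = schrodingerSB (LinearMap.mul F F) ψ hl hb h (T f)) :
    ∃ c : ℂ, ∀ f : SchwartzBruhat F, T f = c • f := by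
  obtain ⟨m, hm⟩ := hψ.exists_hasConductorExp
  refine ⟨((T (ballSB F 0) : SchwartzBruhat F) : F → ℂ) 0, fun f => ?_⟩
  obtain ⟨N₀, hN₀⟩ := exists_forall_add_eq_of_mem_schwartzBruhat f.2
  have hfN := forall_add_eq_of_le (le_max_left N₀ 0) hN₀
  rw [commutant_eq_smul_of_forall_add_eq hl hb hm T hT f hfN]
  congr 1
  -- `c_N = c_0`: apply the same to `1_𝒪`, which is `𝔭^N`-invariant (`N ≥ 0`)
  have h0 : ∀ x, ∀ t ∈ primePowBall F (max N₀ 0),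
      ((ballSB F 0 : SchwartzBruhat F) : F → ℂ) (x + t) = ((ballSB F 0 : SchwartzBruhat F) : F → ℂ) x :=
    fun x t ht => indicator_primePowBall_add_eq (le_max_right N₀ 0) x ht
  have h := commutant_eq_smul_of_forall_add_eq hl hb hm T hT (ballSB F 0) h0
  have h' := congr_arg (fun w : SchwartzBruhat F => (w : F → ℂ) 0) h
  simp only [Submodule.coe_smul, Pi.smul_apply, smul_eq_mul] at h'
  rw [coe_ballSB, Set.indicator_of_mem (zero_mem_primePowBall 0), mul_one] at h'
  exact h'.symm

/-! ## §3 Implementers are unique up to a scalar -/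

/-- `𝒮(F)` is non-trivial: `1_𝒪 ≠ 0`. [folklore] -/
theorem ballSB_zero_ne_zero : (ballSB F 0 : SchwartzBruhat F) ≠ 0 := by
  intro h
  have h' := congr_arg (fun w : SchwartzBruhat F => (w : F → ℂ) 0) h
  simp only [coe_ballSB, Set.indicator_of_mem (zero_mem_primePowBall 0), ZeroMemClass.coe_zero,
    Pi.zero_apply] at h'
  exact one_ne_zero h'

variable [Invertible (2 : F)]

/-- **MVW II.1 "`M` est unique à un scalaire près", KERNEL in rank one**: the predicate
`ImplementerUniqueUpToScalar` of `LocalWeilProjective.lean` holds for the smooth Schrödinger model of a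
non-archimedean local field (`ψ` continuous non-trivial, `2` invertible). [cite: MoeglinVignerasWaldspurger1987, Chap. 2 II.1] -/
theorem implementerUniqueUpToScalar_schrodingerSB_rankOne (hψ : ψ.IsContinuousNontrivial) :
    ImplementerUniqueUpToScalar (schrodingerSB (LinearMap.mul F F) ψ hl hb) := by
  intro g M M' hM hM'
  have hq := Implements.mul _ (Implements.inv _ hM) hM'
  rw [inv_mul_cancel] at hq
  have hT : ∀ (h : Heisenberg (polar (LinearMap.mul F F))) (f : SchwartzBruhat F),
      ((M⁻¹ * M' : SchwartzBruhat F ≃ₗ[ℂ] SchwartzBruhat F) : SchwartzBruhat F →ₗ[ℂ] SchwartzBruhat F)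
          (schrodingerSB (LinearMap.mul F F) ψ hl hb h f)
        = schrodingerSB (LinearMap.mul F F) ψ hl hb h
          (((M⁻¹ * M' : SchwartzBruhat F ≃ₗ[ℂ] SchwartzBruhat F) : SchwartzBruhat F →ₗ[ℂ] SchwartzBruhat F) f) := by
    intro h f
    have := hq h f
    rwa [Heisenberg.PseudoSymplectic.act_one] at this
  obtain ⟨c, hc⟩ := commutant_schrodingerSB_rankOne hl hb hψ _ hT
  simp only [LinearEquiv.coe_coe] at hc
  have hc0 : c ≠ 0 := by
    intro h0
    have h1 := hc (ballSB F 0)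
    rw [h0, zero_smul, ← (M⁻¹ * M').map_zero] at h1
    exact ballSB_zero_ne_zero ((M⁻¹ * M').injective h1)
  refine ⟨Units.mk0 c hc0, fun f => ?_⟩
  rw [Units.val_mk0]
  calc M' f = M ((M⁻¹ * M') f) := by
          rw [LinearEquiv.mul_apply, LinearEquiv.coe_inv, LinearEquiv.apply_symm_apply]
    _ = M (c • f) := by rw [hc f]
    _ = (c : ℂ) • M f := map_smul M c f

/-- **`ker p = im i` for the rank-one smooth Schrödinger model, KERNEL.** [cite: MoeglinVignerasWaldspurger1987, Chap. 2 II.1 (B)] -/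
theorem ker_proj_eq_range_ofScalar_schrodingerSB_rankOne (hψ : ψ.IsContinuousNontrivial) :
    (MpPsi.proj (schrodingerSB (LinearMap.mul F F) ψ hl hb)).ker
      = (MpPsi.ofScalar (schrodingerSB (LinearMap.mul F F) ψ hl hb)).range :=
  MpPsi.ker_proj_eq_range_ofScalar _ (implementerUniqueUpToScalar_schrodingerSB_rankOne hl hb hψ)

/-! ## §4 The rank-one local metaplectic-type extension is a central extension (KERNEL) -/

section Measured

variable [MeasurableSpace F] [BorelSpace F] (μ : Measure F) [μ.IsAddHaarMeasure]

/-- **(B) in rank one, KERNEL**: for `ψ` continuous non-trivial with a self-dual Haar measure `μ` (Tate Thm 2.2.2)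
and `2` invertible, `1 → ℂˣ → S̃p_ψ(F × F) → SL₂(F) → 1` (`MpPsi.ofScalar`, `MpPsi.proj` of the smooth Schrödinger
model) is a central extension: existence of implementers by `RankOneGeneration.lean`, uniqueness up to scalars by §3.
[cite: MoeglinVignerasWaldspurger1987, Chap. 2 II.1 (B)] -/
theorem isCentralExt_schrodingerSB_rankOne (hψ : ψ.IsContinuousNontrivial) (hμ : IsSelfDualMeasure ψ μ) :
    IsCentralExt
      (MpPsi.ofScalar (schrodingerSB (LinearMap.mul F F) ψ (isLocallyConstant_of_isContinuousNontrivial hψ)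
        continuous_mul_left_apply))
      (MpPsi.proj (schrodingerSB (LinearMap.mul F F) ψ (isLocallyConstant_of_isContinuousNontrivial hψ)
        continuous_mul_left_apply)) :=
  isCentralExt_MpPsi _ (existsImplementer_schrodingerSB_rankOne ψ μ hψ hμ)
    (implementerUniqueUpToScalar_schrodingerSB_rankOne _ _ hψ)

end Measured

/-- **(A) in rank one, hypothesis-free**: for every continuous non-trivial `ψ` (and `2` invertible) every
`g ∈ SL₂(F) = Sp(F × F)` is implemented on the smooth Schrödinger model — the self-dual Haar measure entering the
Weyl operator EXISTS (`exists_isSelfDualMeasure`, Tate Thm 2.2.2 kernel). [cite: MoeglinVignerasWaldspurger1987, Chap. 2 II.1 (A)] -/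
theorem existsImplementer_schrodingerSB_rankOne' (hψ : ψ.IsContinuousNontrivial) :
    ExistsImplementer (schrodingerSB (LinearMap.mul F F) ψ (isLocallyConstant_of_isContinuousNontrivial hψ)
      continuous_mul_left_apply) := by
  letI : MeasurableSpace F := borel F
  haveI : BorelSpace F := ⟨rfl⟩
  obtain ⟨ν, hν, hsd⟩ := exists_isSelfDualMeasure (F := F) hψ
  exact existsImplementer_schrodingerSB_rankOne ψ ν hψ hsd

/-- **(B) in rank one, hypothesis-free, KERNEL**: for every continuous non-trivial `ψ` of a non-archimedean local
field `F` with `2` invertible, `1 → ℂˣ → S̃p_ψ(F × F) → SL₂(F) → 1` (`MpPsi.ofScalar`, `MpPsi.proj` of the smooth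
Schrödinger model) is a central extension with `ker p = im i`. [cite: MoeglinVignerasWaldspurger1987, Chap. 2 II.1 (B)] -/
theorem isCentralExt_schrodingerSB_rankOne' (hψ : ψ.IsContinuousNontrivial) :
    IsCentralExt
      (MpPsi.ofScalar (schrodingerSB (LinearMap.mul F F) ψ (isLocallyConstant_of_isContinuousNontrivial hψ)
        continuous_mul_left_apply))
      (MpPsi.proj (schrodingerSB (LinearMap.mul F F) ψ (isLocallyConstant_of_isContinuousNontrivial hψ)
        continuous_mul_left_apply)) :=
  isCentralExt_MpPsi _ (existsImplementer_schrodingerSB_rankOne' hψ)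
    (implementerUniqueUpToScalar_schrodingerSB_rankOne _ _ hψ)

end Commutant

end Literature.RepresentationTheory.HeisenbergGroup
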